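import Summits.QuantumFields.BalabanUV.T4Continuum.Support.BlockAverageLogInteraction
import HarnessLib

/-!
# T⁴ programme, node NE3, row S6-Y7 (P3 leaf L7 «SLOP», k-level input (K4), file 2∕2) — GAUGE EXTRACTION AT ONE BOND:
# `W·e^{gaugeDir W Λ + R} = e^{Λ(x)} · (W·e^{R′}) · e^{−Λ(x+e_μ)}` with the INTERACTION bound
# `‖R′ − R‖ ≤ 2048·(‖Λ(x)‖·‖R − Λ(x+e_μ)‖ + ‖Λ(x+e_μ)‖·‖R‖)` — no `‖Λ(x)‖²` self-term (`BlockAverageGaugeExtract`)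

Cell `pub-balaban`, NE3 formalisation swarm (`t4/formal/NE3/LEAVES.md` row S5∕S6, sub-row S6-Y7; unit
`b2b-balaban-t4-ne3-formalise-leaf-10`, gen 2); sequel of `BlockAverageLogInteraction` (two-variable Schwarz lemma; the two
elementary logarithms `logF`, `logK` are bilinearly small).  SHAPE `Statements/S6-Y7-SHAPE-v1.md` §2′ (K4): before the one-step
quadratic remainder (`BlockAverageQuadRemainder`) may be charged to a direction `Y = gaugeDir W Λ + R` with a large gauge
component, the gauge component is EXTRACTED as an exact gauge transformation, `W(b)e^{Y(b)} = u(x)(W(b)e^{R′(b)})u(x+e_μ)⁻¹`,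
`u = e^{Λ}`, where `R′ = gaugeExtract W Λ R` differs from `R` only by INTERACTION terms (products of the charges at the two ends of
the bond, or of a charge with `R`): an isolated charge is extracted exactly.

HONEST FRAMING: finite-`T⁴` kinematics at ONE bond (rung (B)+1 — NOT infinite volume, NOT a mass gap, NOT Clay); local matrix
analysis; nothing of NE3 is claimed (NE3-E stays CONDITIONAL on the co-owners' ⟨named structures⟩; the k-level L7(a) stays OPEN ∕
road P3's typed binder — (K5)–(K6) are not here); no `BetaPertH`, no (B), no G-an2-4; no printed sentence is a hypothesis
([cite:] tags are context).  PLACEMENT (human rule 2026-08-19): our work, under `Summits/QuantumFields/BalabanUV/`.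
-/

set_option autoImplicit false

open scoped BigOperators Matrix.Norms.L2Operator Topology
open NormedSpace Finset Filter Metric Set

namespace Summit.QuantumFields.BalabanUV.T4Continuum.BlockAverageGaugeExtract

open Literature.MathematicalPhysics.QuantumFieldTheory.Balaban1983to89
open B7Prop1Explicit B7Prop2Explicit MatrixLog UnitaryModel
open T4AveragingDeficitWall hiding Site Plane Plaq Bond
open BlockAveragePushDirGauge (gaugeDir)
open BlockAverageLogInteraction

noncomputable section

variable {d : ℕ} {n : Type*} [Fintype n] [DecidableEq n]

/-! ## §3 Gauge extraction at one bond -/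

section Extract

variable [Nonempty n]

/-- THE EXTRACTED NON-GAUGE FIELD at the bond `b = ⟨x, x+e_μ⟩`:
`R′(b) = log( e^{−Ad_{W(b)⁻¹}Λ(x)} · e^{gaugeDir W Λ (b) + R(b)} · e^{Λ(x+e_μ)} )`. [folklore] -/
def gaugeExtract (W : Site d → Fin d → (Matrix n n ℂ)ˣ) (Λ : Site d → Matrix n n ℂ) (R : Site d → Fin d → Matrix n n ℂ)
    (x : Site d) (μ : Fin d) : Matrix n n ℂ :=
  mlog (exp (-(Ad (W x μ)⁻¹ (Λ x))) * exp (gaugeDir W Λ x μ + R x μ) * exp (Λ (x + e μ)))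

omit [Nonempty n] in
/-- The extracted field telescopes through the two elementary logarithms of §2:
`R′ − R = F(a, R − Λ₊, Λ₊)(1,1) + K(Λ₊, R)(1,1)`, `a = Ad_{W⁻¹}Λ(x)`, `Λ₊ = Λ(x+e_μ)`. [folklore] -/
theorem gaugeExtract_sub_eq (W : Site d → Fin d → (Matrix n n ℂ)ˣ) (Λ : Site d → Matrix n n ℂ)
    (R : Site d → Fin d → Matrix n n ℂ) (x : Site d) (μ : Fin d) :
    gaugeExtract W Λ R x μ - R x μ
      = logF (Ad (W x μ)⁻¹ (Λ x)) (R x μ - Λ (x + e μ)) (Λ (x + e μ)) 1 1 + logK (Λ (x + e μ)) (R x μ) 1 1 := by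
  simp only [gaugeExtract, logF, logK, gaugeDir, one_smul]
  have e1 : Ad (W x μ)⁻¹ (Λ x) - Λ (x + e μ) + R x μ = Ad (W x μ)⁻¹ (Λ x) + (R x μ - Λ (x + e μ)) := by abel
  rw [e1]
  abel

/-- **THE INTERACTION BOUND**: for a `U(N)`-valued bond variable and `‖Λ(x)‖ < 1∕32`, `‖Λ(x+e_μ)‖ < 1∕64`, `‖R(b)‖ < 1∕64`,
`‖R′(b) − R(b)‖ ≤ 2048·( ‖Λ(x)‖·‖R(b) − Λ(x+e_μ)‖ + ‖Λ(x+e_μ)‖·‖R(b)‖ )` — products of the gauge charges at the two ends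
of the bond, or of a charge with `R`; NO `‖Λ(x)‖²` term (an isolated charge is extracted exactly). [folklore] -/
theorem norm_gaugeExtract_sub_le {W : Site d → Fin d → (Matrix n n ℂ)ˣ} (hW : IsUnitaryCfg W) (Λ : Site d → Matrix n n ℂ)
    (R : Site d → Fin d → Matrix n n ℂ) (x : Site d) (μ : Fin d)
    (hΛx : ‖Λ x‖ < 1 / 32) (hΛx' : ‖Λ (x + e μ)‖ < 1 / 64) (hR : ‖R x μ‖ < 1 / 64) :
    ‖gaugeExtract W Λ R x μ - R x μ‖
      ≤ 2048 * (‖Λ x‖ * ‖R x μ - Λ (x + e μ)‖ + ‖Λ (x + e μ)‖ * ‖R x μ‖) := by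
  have ha : ‖Ad (W x μ)⁻¹ (Λ x)‖ = ‖Λ x‖ :=
    AveragingDeficitTransport.norm_Ad_of_unitary ((unitaryUnits _).inv_mem (hW x μ)) _
  have hz : ‖R x μ - Λ (x + e μ)‖ < 1 / 32 := by
    refine (norm_sub_le _ _).trans_lt ?_; linarith
  have h1 := norm_logF_one_one_le (a := Ad (W x μ)⁻¹ (Λ x)) (z := R x μ - Λ (x + e μ)) (b := Λ (x + e μ))
    (by rw [ha]; exact hΛx) hz (by linarith)
  have h2 := norm_logK_one_one_le (b := Λ (x + e μ)) (R := R x μ) (by linarith) (by linarith)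
  rw [gaugeExtract_sub_eq]
  refine (norm_add_le _ _).trans ?_
  rw [ha] at h1
  have e : 2 * (‖Λ x‖ / (1 / 32)) * (‖R x μ - Λ (x + e μ)‖ / (1 / 32))
      + 2 * (‖Λ (x + e μ)‖ / (1 / 32)) * (‖R x μ‖ / (1 / 32))
      = 2048 * (‖Λ x‖ * ‖R x μ - Λ (x + e μ)‖ + ‖Λ (x + e μ)‖ * ‖R x μ‖) := by ring
  linarith [add_le_add h1 h2]

/-- In the same regime the triple product lies in the ball of (21), so `e^{R′} = e^{−a}e^{G+R}e^{Λ₊}`. [folklore] -/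
theorem exp_gaugeExtract {W : Site d → Fin d → (Matrix n n ℂ)ˣ} (hW : IsUnitaryCfg W) (Λ : Site d → Matrix n n ℂ)
    (R : Site d → Fin d → Matrix n n ℂ) (x : Site d) (μ : Fin d)
    (hΛx : ‖Λ x‖ < 1 / 32) (hΛx' : ‖Λ (x + e μ)‖ < 1 / 64) (hR : ‖R x μ‖ < 1 / 64) :
    exp (gaugeExtract W Λ R x μ)
      = exp (-(Ad (W x μ)⁻¹ (Λ x))) * exp (gaugeDir W Λ x μ + R x μ) * exp (Λ (x + e μ)) := by
  have ha : ‖Ad (W x μ)⁻¹ (Λ x)‖ = ‖Λ x‖ :=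
    AveragingDeficitTransport.norm_Ad_of_unitary ((unitaryUnits _).inv_mem (hW x μ)) _
  have hctl := (logF_control (a := Ad (W x μ)⁻¹ (Λ x)) (z := R x μ - Λ (x + e μ)) (b := Λ (x + e μ)) (σ := 1) (τ := 1)
    (by rw [norm_one, one_mul, ha]; exact hΛx.le)
    (by rw [norm_one, one_mul]; exact ((norm_sub_le _ _).trans (by linarith))) (by linarith)).1
  simp only [one_smul] at hctl
  have e1 : Ad (W x μ)⁻¹ (Λ x) + (R x μ - Λ (x + e μ)) = gaugeDir W Λ x μ + R x μ := by
    simp only [gaugeDir]; abel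
  rw [e1] at hctl
  unfold gaugeExtract
  exact exp_mlog (hctl.trans_lt (by norm_num))

/-- **GAUGE EXTRACTION AT ONE BOND** (exact): `W(b)·e^{gaugeDir W Λ (b) + R(b)} = e^{Λ(x)} · (W(b)·e^{R′(b)}) · e^{−Λ(x+e_μ)}` —
the direction `gaugeDir W Λ + R` moves `W` to the gauge transform by `u = e^{Λ}` of `W·e^{R′}`
(`vary W (gaugeDir W Λ + R) 1 (b) = gaugeAct (e^{Λ}) (vary W R′ 1) (b)` at the matrix level). [folklore] -/
theorem val_mul_exp_gaugeDir_add {W : Site d → Fin d → (Matrix n n ℂ)ˣ} (hW : IsUnitaryCfg W) (Λ : Site d → Matrix n n ℂ)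
    (R : Site d → Fin d → Matrix n n ℂ) (x : Site d) (μ : Fin d)
    (hΛx : ‖Λ x‖ < 1 / 32) (hΛx' : ‖Λ (x + e μ)‖ < 1 / 64) (hR : ‖R x μ‖ < 1 / 64) :
    ((W x μ : (Matrix n n ℂ)ˣ) : Matrix n n ℂ) * exp (gaugeDir W Λ x μ + R x μ)
      = exp (Λ x) * (((W x μ : (Matrix n n ℂ)ˣ) : Matrix n n ℂ) * exp (gaugeExtract W Λ R x μ)) * exp (-(Λ (x + e μ))) := by
  letI : NormedAlgebra ℚ (Matrix n n ℂ) := NormedAlgebra.restrictScalars ℚ ℝ (Matrix n n ℂ)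
  rw [exp_gaugeExtract hW Λ R x μ hΛx hΛx' hR]
  -- `W · e^{−Ad_{W⁻¹}Λ} = e^{−Λ} · W`
  have hconj : ((W x μ : (Matrix n n ℂ)ˣ) : Matrix n n ℂ) * exp (-(Ad (W x μ)⁻¹ (Λ x)))
      = exp (-(Λ x)) * ((W x μ : (Matrix n n ℂ)ˣ) : Matrix n n ℂ) := by
    have h := exp_units_conj (W x μ)⁻¹ (-(Λ x))
    simp only [inv_inv] at h
    have e1 : -(Ad (W x μ)⁻¹ (Λ x)) = (((W x μ)⁻¹ : (Matrix n n ℂ)ˣ) : Matrix n n ℂ) * -(Λ x) * ((W x μ : (Matrix n n ℂ)ˣ) : Matrix n n ℂ) := by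
      simp only [Ad, inv_inv]; noncomm_ring
    rw [e1, h, ← mul_assoc, ← mul_assoc, Units.mul_inv, one_mul]
  -- `e^{Λ₊} e^{−Λ₊} = 1`, `e^{Λ} e^{−Λ} = 1`
  have hcancel : exp (Λ (x + e μ)) * exp (-(Λ (x + e μ))) = 1 := by
    have := (expUnit (Λ (x + e μ))).val_inv
    simpa [expUnit] using this
  have hcancel' : exp (Λ x) * exp (-(Λ x)) = 1 := by
    have := (expUnit (Λ x)).val_inv
    simpa [expUnit] using this
  calc ((W x μ : (Matrix n n ℂ)ˣ) : Matrix n n ℂ) * exp (gaugeDir W Λ x μ + R x μ)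
      = (exp (Λ x) * exp (-(Λ x))) * ((W x μ : (Matrix n n ℂ)ˣ) : Matrix n n ℂ) * exp (gaugeDir W Λ x μ + R x μ)
          * (exp (Λ (x + e μ)) * exp (-(Λ (x + e μ)))) := by rw [hcancel, hcancel', one_mul, mul_one]
    _ = exp (Λ x) * ((exp (-(Λ x)) * ((W x μ : (Matrix n n ℂ)ˣ) : Matrix n n ℂ)) * exp (gaugeDir W Λ x μ + R x μ)
          * exp (Λ (x + e μ))) * exp (-(Λ (x + e μ))) := by noncomm_ring
    _ = exp (Λ x) * (((W x μ : (Matrix n n ℂ)ˣ) : Matrix n n ℂ)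
          * (exp (-(Ad (W x μ)⁻¹ (Λ x))) * exp (gaugeDir W Λ x μ + R x μ) * exp (Λ (x + e μ))))
          * exp (-(Λ (x + e μ))) := by rw [← hconj]; noncomm_ring

end Extract

end

end Summit.QuantumFields.BalabanUV.T4Continuum.BlockAverageGaugeExtract
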